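import Literature.MathematicalPhysics.QuantumFieldTheory.Balaban1983to89.B9Eq326OperatorAssembly
import Literature.MathematicalPhysics.QuantumFieldTheory.Balaban1983to89.B9Eq319QprimeBlockLocal
import Literature.MathematicalPhysics.QuantumFieldTheory.Balaban1983to89.B9Eq349LaplacePrimeBlockLetters
import Literature.MathematicalPhysics.QuantumFieldTheory.Balaban1983to89.B9Eq387CubeLocalisedProjection

/-!
# `Balaban1983to89.B9Eq387CubeProjectionLocality` — T. Bałaban, *Propagators for lattice gauge theories in a background field*, Commun. Math. Phys. **99**
# (1985) 389–434 [Balaban1985BackgroundPropagators] Cor 3.6 p. 408 with (3.87)–(3.89) p. 409, (3.19) p. 393, (3.3)/(3.8) pp. 390–392, (3.21)–(3.23) p. 394: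
# **THE CUBE PROJECTION `R_□(U)` AND THE DERIVATIVE LETTERS ON CUBE-SUPPORTED FIELDS READ THE BACKGROUND ONLY OVER THE CUBE's 1-NEIGHBOURHOOD**
# — the locality half of print's per-cube gauge reduction («If a configuration U satisfies (3.35) … then Theorems 3.1–3.3 hold for the operators
# G′_□(U), …», Cor 3.6): route R2′ STEP B7′∕B8′, S-P6′, instance-ledger row L10 (loc) of the pub-balaban NE9 chain (`t4/ROUTES-NE9.md` v13.45)

statement-level skeleton of published theorems with citation tags; proofs where landed; nothing here is a claim about the Yang–Mills mass gap

CITATION HEADER (lean-in-tree rule).  Audit cell `pub-balaban`, sub-cell `t4`, BINDER row NE9; filed by NE9 formalisation-swarm LEAF PROVER 05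
(`b2b-balaban-t4-ne9-formalise-leaf-05`, gen 78) as [folklore] bookkeeping on the cell's own objects: `B9Eq319QprimeTorus.Qprime ∕ QprimeLin ∕ contour ∕
blockOf ∕ blockCoord` ((3.19) with the [B5] (1.7) contours), ne9-leaf-03's `B9Eq319QprimeBlockLocal.blockCoord_eq_of_mem_contour` (the contour stays
in the block), `B9Eq326OperatorAssembly.QprimeW`, `B9Eq33CovDerivVector.covDeriv ∕ covDiv` ((3.3), (3.8)),
`B11Eq103H1Complex.covDerivL2K ∕ covDivL2K ∕ covLaplaceSiteK ∕ projR ∕ adjoint_covDerivL2K` ((3.3), (3.8), (3.23), (3.21)), `B9Eq310HessianOperator.adTransportW`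
(`R(U(b))` on the Hilbert fibre), ne9-leaf-01's `B9Eq349LaplacePrimeBlockLetters.tdist_blockCoord_shift_le_one`, ne9-leaf-06's
`B9Eq387CubeLocalisedProjection.hasOrthogonalProjection_of_finiteDimensional`.  CONSUMERS BY SHAPE: the cube projection `projR Δ^η_U (Q′ × N.mkQ)` of
`B9Eq387CubeLocalisedProjectionLattice ∕ …BumpSection ∕ …Profile ∕ …Adjoint` (S-P6′(β)) and `B9Eq387CubeLocalisedProjection.cube_form_ge′` (S-P6′(γ)).
Source READ in the held text [Balaban1985BackgroundPropagators] (journal page = PDF page + 388): p. 408 Cor 3.6; p. 409 (3.87)–(3.89) («operators … restricted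
to the cube □̃»); p. 393 (3.19) («Γ_{y,x} … a contour … contained in B(y)»); pp. 390–392 (3.3), (3.8); p. 394 (3.21)–(3.23).  NOTHING of print's estimates is
asserted or valued.

WHY (row L10, the (3.35)-class (loc)).  The strong small-field coercivity inputs of the Tier-P assembly (`B9Thm311SmallFieldCoercivityUniform`, the S-P6′(β)
chain, ne9-leaf-06's (γ)) want a background that is small on EVERY bond, while print's (3.35) makes `U` small only in a gauge on the enlarged cube `□⁺`
(S-P4, `B7Eq44TorusAxialGaugeLocal`).  The bridge is `Ũ := U^g` on `□⁺`, `:= 1` elsewhere: `Ũ` is globally small, and the cube form at `U^g` equals the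
cube form at `Ũ` term by term BECAUSE every cube operator reads the background only next to the cube.  This file proves that locality for the
derivative letters, for (3.19) and for the cube projection `R_□`; the gauge step `U^g ↔ U` is `B9Eq328GaugeAction` ∕ `B9Eq333ProjectionCovariance`.

WHAT IS PROVED (sorry-free; proof lane — no `def`; [folklore]).
* §1 (3.19) reads `U` inside the block: `pathTr_congr`, `stepTransport_congr`, then — with ne9-leaf-03's `B9Eq319QprimeBlockLocal.blockCoord_eq_of_mem_contour`
  (every site of `Γ_{y,x}` lies in `B(y)`) — **`Qprime_congr_of_block`** (`Rb = Rb′` on the bonds based in `B(y)` ⇒ `(Q′λ)(y)` agrees, ANY `λ`), **`QprimeW_congr_of_support`** (`λ`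
  supported over the blocks of `Y`, `U = Ũ` on the bonds based in those blocks ⇒ `Q′(U)λ = Q′(Ũ)λ`).
* §2 (3.3)∕(3.4)∕(3.8)∕(3.23) read the transporters next to the support: **`covDerivL2K_congr`**, **`covDivL2K_congr`**, **`covCurlL2K_congr`** (ANY
  predicate on bonds ∕ sites: transporters agreeing where the field lives), **`covCurlL2K_congr_of_support`** (`A` supported over `Z₀`, transporters
  agreeing on every bond whose base block is within coarse distance `1` of `Z₀`), **`covLaplaceSiteK_congr_of_support`** (`f` supported over the blocks of `Y`, transporters agreeing on every bond whose
  base block is within coarse distance `1` of `Y`), **`adjoint_covDerivL2K_congr_of_support`** (`D_U†z = D_Ũ†z` for a bond field `z` supported over `Z₀`,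
  `U = Ũ` on the bonds based in `Z₀`, under `hRS` for both).
* §3 **`projR_congr`** (abstract `B11Eq103H1Complex.projR`): equal constraint kernels on which `Δ₁ = Δ₂` ⇒ `projR Δ₁ Q₁ = projR Δ₂ Q₂`.
* §4 **`cube_projR_congr_of_background`** — with the S-P6′ letters `hN` (`N` = site fields supported over the blocks of the cube `Y`), `hΔs`, `hQ′` for `U`
  and for `Ũ`, and ONE agreement letter `∀ b, (∃ y ∈ Y, d_m(y, blk b₋) ≤ 1) → U b = Ũ b`:  `projR Δ^η_U (Q′_U × N.mkQ) = projR Δ^η_Ũ (Q′_Ũ × N.mkQ)`.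
  NO smallness, NO window; every `U, Ũ : Bond → 𝔸ˣ`, every volume with `m_i ≥ 1`.
HONEST SCOPE.  Locality of the `R_□` ∕ `D` ∕ `D†` ∕ `curl` ∕ `Δ^η` ∕ `Q′` letters only; the vector averaging `Q(U)` (`QtorusW`) part of the bond form, the
gauge step and the axial gauge itself are NOT here; the GLOBAL `R(U)` is NOT local (that is why S-P6′ exists) and nothing is said about it.  NOT NE9 (cell
pub-balaban: NE9 NOT PRINTED ∕ NOT PROVED; «NE9 ⇐ the named binders»; row WALLED ON A MODEL (O-NE9-1; #5 UNRULED); spine PROVED 0∕9; rung (B)+1 on a finite T⁴ —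
NOT infinite volume, NOT mass gap, NOT Clay; HONEST DEPENDENCY: continuum YM on T⁴ ⇐ BetaPertH ∧ nine spine estimates (0/9 proved); BetaPertH ⇐ (D1) ∧ (D4) ∧
CAP+tail; G-an2-4 gates asym, D1 and NE2/3/4).  NEW file; nothing modified.  Net new unproved facts: 0.
-/

noncomputable section

set_option autoImplicit false

open scoped InnerProductSpace ComplexConjugate BigOperators

namespace Literature.MathematicalPhysics.QuantumFieldTheory.Balaban1983to89.B9Eq387CubeProjectionLocality

open B4Sect5Torus (TSite tdist tdist_self tdist_symm)
open B9SectCLatticeCarrier (Bond bpos btgt shift unshift)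
open B9Eq311L2Pairing (WL2)
open B9Eq323Ker (pathTr pathTr_cons_cons avgQ)
open B9Eq319QprimeTorus (fineP blockCoord blockOf centre contour stepTransport Qprime QprimeLin QprimeLin_apply mem_blockOf_iff blockCoord_centre)
open B9Eq319QprimeBlockLocal (blockCoord_eq_of_mem_contour)
open B9Eq33CovDerivVector (covDeriv_apply covDiv_apply)
open B9Eq34CovCurlVector (covCurl_apply_coord)
open B11Eq103H1Complex (SiteL2K BondL2K covDerivL2K covDivL2K covLaplaceSiteK projR equiv_covDerivL2K equiv_covDivL2K adjoint_covDerivL2K)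
open B9Eq310HessianOperator (adTransportW adTransportW_apply PlaqL2K covCurlL2K equiv_covCurlL2K)
open B9Eq326OperatorAssembly (QprimeW)
open B9Eq349LaplacePrimeBlockLetters (tdist_blockCoord_shift_le_one)
open B9Eq387CubeLocalisedProjection (hasOrthogonalProjection_of_finiteDimensional)

/-! ## §1 (3.19) reads the background inside the block -/

section PathTr

variable {X V : Type*} [AddCommGroup V] [Module ℝ V]

/-- Two step-transport data agreeing at every site of a path give the same transport `R(U(Γ))` along it. [folklore]
[cite: Balaban1985BackgroundPropagators, (3.19) p.393] -/
theorem pathTr_congr {τ τ' : X → X → V →ₗ[ℝ] V} :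
    ∀ p : List X, (∀ a ∈ p, τ a = τ' a) → pathTr τ p = pathTr τ' p
  | [], _ => rfl
  | [_], _ => rfl
  | x :: x' :: rest, h => by
    rw [pathTr_cons_cons, pathTr_cons_cons, h x List.mem_cons_self,
      pathTr_congr (x' :: rest) fun a ha => h a (List.mem_cons_of_mem x ha)]

end PathTr

section Block

variable {d : ℕ} (L : ℕ) [NeZero L] (m : Fin d → ℕ) {V : Type*} [AddCommGroup V] [Module ℝ V]

omit [NeZero L] in
/-- The step transporter at a site depends on the bond data at the bonds based there only. [folklore]
[cite: Balaban1985BackgroundPropagators, (3.19) p.393] -/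
theorem stepTransport_congr {Rb Rb' : Bond d (fineP L m) → V →ₗ[ℝ] V} {s : TSite d (fineP L m)} (h : ∀ κ : Fin d, Rb (s, κ) = Rb' (s, κ)) :
    stepTransport L m Rb s = stepTransport L m Rb' s := by
  funext s'
  unfold stepTransport
  split_ifs with hs
  · exact h _
  · rfl

/-- **(3.19) READS THE BACKGROUND INSIDE THE BLOCK**: if two bond-transporter data agree on every bond based in `B(y)`, then `(Q′λ)(y)` is the same for
both, for EVERY `λ` — the contours `Γ_{y,x}`, `x ∈ B(y)`, run inside `B(y)`. [cite: Balaban1985BackgroundPropagators, (3.19) p.393] -/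
theorem Qprime_congr_of_block {Rb Rb' : Bond d (fineP L m) → V →ₗ[ℝ] V} (y : TSite d m)
    (h : ∀ s : TSite d (fineP L m), blockCoord L m s = y → ∀ κ : Fin d, Rb (s, κ) = Rb' (s, κ)) (l : TSite d (fineP L m) → V) :
    Qprime L m Rb l y = Qprime L m Rb' l y := by
  simp only [Qprime, avgQ]
  refine Finset.sum_congr rfl fun x hx => ?_
  rw [mem_blockOf_iff] at hx
  rw [pathTr_congr (centre L m y :: contour L m x) fun a ha => ?_]
  rw [List.mem_cons] at ha
  rcases ha with rfl | ha
  · exact stepTransport_congr L m (h _ (blockCoord_centre L m y))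
  · exact stepTransport_congr L m (h _ ((blockCoord_eq_of_mem_contour L m ha).trans hx))

/-- `(Q′λ)(y) = 0` when `λ` vanishes on `B(y)` — a sum of zeros ((3.19) reads `λ` on `B(y)` only); no window. [cite: Balaban1985BackgroundPropagators, (3.19) p.393] -/
private theorem Qprime_eq_zero_of_vanish (Rb : Bond d (fineP L m) → V →ₗ[ℝ] V) (y : TSite d m) (l : TSite d (fineP L m) → V)
    (hl : ∀ x : TSite d (fineP L m), blockCoord L m x = y → l x = 0) : Qprime L m Rb l y = 0 := by
  simp only [Qprime, avgQ]
  exact Finset.sum_eq_zero fun x hx => by rw [hl x ((mem_blockOf_iff L m y x).1 hx), map_zero, smul_zero]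

end Block

section QprimeW

variable {d : ℕ} (L : ℕ) [NeZero L] (m : Fin d → ℕ) {𝔸 : Type*} [Ring 𝔸] [Algebra ℂ 𝔸]
  {W : Type*} [NormedAddCommGroup W] [InnerProductSpace ℂ W] (φ : W ≃ₗ[ℂ] 𝔸) {c₀ : ℝ}

/-- Transporters `R(U(b))` of two backgrounds agree on a bond where the backgrounds agree. [folklore]
[cite: Balaban1985BackgroundPropagators, p.390] -/
theorem adTransportW_congr {Pd : Fin d → ℕ} {U Ũ : Bond d Pd → 𝔸ˣ} {b : Bond d Pd} (h : U b = Ũ b) :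
    adTransportW φ U b = adTransportW φ Ũ b :=
  LinearMap.ext fun w => by rw [adTransportW_apply, adTransportW_apply, h]

/-- … and so do the adjoint transporters `R(U(b)⁻¹)`. [folklore] [cite: Balaban1985BackgroundPropagators, p.390, (3.8) p.392] -/
theorem adTransportW_inv_congr {Pd : Fin d → ℕ} {U Ũ : Bond d Pd → 𝔸ˣ} {b : Bond d Pd} (h : U b = Ũ b) :
    adTransportW φ (fun b => (U b)⁻¹) b = adTransportW φ (fun b => (Ũ b)⁻¹) b :=
  LinearMap.ext fun w => by rw [adTransportW_apply, adTransportW_apply, h]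

/-- **`Q′(U)λ = Q′(Ũ)λ` FOR `λ` SUPPORTED OVER THE BLOCKS OF `Y` WHEN `U = Ũ` ON THE BONDS BASED IN THOSE BLOCKS** — at `y ∈ Y` by `Qprime_congr_of_block`,
at `y ∉ Y` both sides vanish ((3.19) reads `λ` on `B(y)` only). [cite: Balaban1985BackgroundPropagators, (3.19) p.393, Cor 3.6 p.408] -/
theorem QprimeW_congr_of_support (U Ũ : Bond d (fineP L m) → 𝔸ˣ) (Y : Set (TSite d m))
    (hUŨ : ∀ b : Bond d (fineP L m), blockCoord L m (bpos b) ∈ Y → U b = Ũ b)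
    (lam : SiteL2K ℂ d (fineP L m) c₀ W) (hlam : ∀ x : TSite d (fineP L m), blockCoord L m x ∉ Y → WL2.equiv ℂ _ W lam x = 0) :
    QprimeW L m φ U (c₀ := c₀) lam = QprimeW L m φ Ũ (c₀ := c₀) lam := by
  funext y
  rw [QprimeW, QprimeW, LinearMap.comp_apply, LinearMap.comp_apply, QprimeLin_apply, QprimeLin_apply]
  by_cases hy : y ∈ Y
  · refine Qprime_congr_of_block L m y (fun s hs κ => ?_) _
    rw [adTransportW_congr φ (hUŨ (s, κ) (by rw [show bpos (s, κ) = s from rfl, hs]; exact hy))]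
  · have hv : ∀ x : TSite d (fineP L m), blockCoord L m x = y →
        (WL2.linearEquiv ℂ ℂ (fun _ : TSite d (fineP L m) => c₀)).toLinearMap lam x = 0 := fun x hx =>
      hlam x (by rw [hx]; exact hy)
    rw [Qprime_eq_zero_of_vanish L m _ y _ hv, Qprime_eq_zero_of_vanish L m _ y _ hv]

end QprimeW

/-! ## §2 (3.3), (3.8), (3.23) read the transporters next to the support -/

section Deriv

variable {𝕜 : Type*} [RCLike 𝕜] {d : ℕ} {Pd : Fin d → ℕ} {W : Type*} [NormedAddCommGroup W] [InnerProductSpace 𝕜 W] {c₀ : ℝ} [Fact (0 < c₀)]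

/-- **(3.3) reads `R` where the differentiated field lives**: `(D_R f)(b) = c(R_b f(b₊) − f(b₋))`; if `R_b = R′_b` on every bond of a family `P` and
`f(b₊) = 0` off `P`, then `D_R f = D_{R′} f`. [folklore] [cite: Balaban1985BackgroundPropagators, (3.3) pp.390–391] -/
theorem covDerivL2K_congr (c : 𝕜) {R R' : Bond d Pd → W →ₗ[𝕜] W} (P : Bond d Pd → Prop) (hRR' : ∀ b, P b → R b = R' b)
    (f : SiteL2K 𝕜 d Pd c₀ W) (hf : ∀ b, ¬ P b → WL2.equiv 𝕜 _ W f (btgt b) = 0) :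
    covDerivL2K 𝕜 c₀ c R f = covDerivL2K 𝕜 c₀ c R' f := by
  apply (WL2.equiv 𝕜 (fun _ : Bond d Pd => c₀) W).injective
  funext b
  rw [equiv_covDerivL2K, equiv_covDerivL2K, covDeriv_apply, covDeriv_apply]
  by_cases hb : P b
  · rw [hRR' b hb]
  · rw [hf b hb, map_zero, map_zero]

/-- **(3.8) reads `S` where the bond field lives**: `(D*_S A)(y) = c·Σ_μ (S(y−e_μ,μ)A(y−e_μ,μ) − A(y,μ))`; if `S_b = S′_b` on `P` and `A(b) = 0` off `P`, then
`D*_S A = D*_{S′} A`. [folklore] [cite: Balaban1985BackgroundPropagators, (3.8) p.392] -/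
theorem covDivL2K_congr (c : 𝕜) {S S' : Bond d Pd → W →ₗ[𝕜] W} (P : Bond d Pd → Prop) (hSS' : ∀ b, P b → S b = S' b)
    (A : BondL2K 𝕜 d Pd c₀ W) (hA : ∀ b, ¬ P b → WL2.equiv 𝕜 _ W A b = 0) :
    covDivL2K 𝕜 c₀ c S A = covDivL2K 𝕜 c₀ c S' A := by
  apply (WL2.equiv 𝕜 (fun _ : TSite d Pd => c₀) W).injective
  funext y
  rw [equiv_covDivL2K, equiv_covDivL2K, covDiv_apply, covDiv_apply]
  congr 1
  refine Finset.sum_congr rfl fun μ _ => ?_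
  by_cases hb : P (unshift μ y, μ)
  · rw [hSS' _ hb]
  · rw [hA _ hb, map_zero, map_zero]

/-- **(3.4) reads `R` where the bond field lives**: `(curl_R A)(p_{μν}(x)) = c(R(x,μ)A(x+e_μ,ν) − A(x,ν)) − c(R(x,ν)A(x+e_ν,μ) − A(x,μ))`; if
`R(x,κ) = R′(x,κ)` at every site `x` of a family `p` and `A` vanishes on the bonds based one step ahead of the other sites, then `curl_R A = curl_{R′} A`.
[folklore] [cite: Balaban1985BackgroundPropagators, (3.4) p.391] -/
theorem covCurlL2K_congr (c : 𝕜) {R R' : Bond d Pd → W →ₗ[𝕜] W} (p : TSite d Pd → Prop) (hRR' : ∀ x, p x → ∀ κ : Fin d, R (x, κ) = R' (x, κ))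
    (A : BondL2K 𝕜 d Pd c₀ W) (hA : ∀ x, ¬ p x → ∀ μ ν : Fin d, WL2.equiv 𝕜 _ W A (shift μ x, ν) = 0) :
    covCurlL2K 𝕜 c₀ c R A = covCurlL2K 𝕜 c₀ c R' A := by
  apply (WL2.equiv 𝕜 (fun _ : B9SectCLatticeCarrier.Plaq d Pd => c₀) W).injective
  funext pq
  obtain ⟨x, q⟩ := pq
  rw [equiv_covCurlL2K, equiv_covCurlL2K, covCurl_apply_coord, covCurl_apply_coord]
  by_cases hx : p x
  · rw [hRR' x hx, hRR' x hx]
  · rw [hA x hx, hA x hx, map_zero, map_zero, map_zero, map_zero]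

end Deriv

section Laplace

variable {𝕜 : Type*} [RCLike 𝕜] {d : ℕ} (L : ℕ) [NeZero L] (m : Fin d → ℕ) {W : Type*} [NormedAddCommGroup W] [InnerProductSpace 𝕜 W]
  {c₀ : ℝ} [Fact (0 < c₀)]

/-- A bond one of whose endpoints lies over `Y` has its base block within coarse distance `1` of `Y`. [folklore]
[cite: Balaban1985Averaging, (2) p.17; Balaban1985BackgroundPropagators, (3.49) p.399] -/
theorem exists_tdist_le_one_of_endpoint (hm : ∀ i, 1 ≤ m i) (Y : Set (TSite d m)) (b : Bond d (fineP L m))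
    (hb : blockCoord L m (bpos b) ∈ Y ∨ blockCoord L m (btgt b) ∈ Y) : ∃ y ∈ Y, tdist m y (blockCoord L m (bpos b)) ≤ 1 := by
  rcases hb with h | h
  · exact ⟨_, h, by rw [tdist_self]; norm_num⟩
  · refine ⟨_, h, ?_⟩
    rw [tdist_symm hm]
    exact tdist_blockCoord_shift_le_one hm (bpos b) b.2

omit [NeZero L] in
/-- **(3.23) `Δ^η = D*D` ON A FIELD SUPPORTED OVER THE BLOCKS OF `Y` READS THE TRANSPORTERS ONLY ON BONDS WITH AN ENDPOINT OVER `Y`** (hence only on bonds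
whose base block is within coarse distance `1` of `Y`). [folklore] [cite: Balaban1985BackgroundPropagators, (3.23) p.394, (3.3) p.391, (3.8) p.392] -/
theorem covLaplaceSiteK_congr_of_support (c : 𝕜) {R R' S S' : Bond d (fineP L m) → W →ₗ[𝕜] W} (Y : Set (TSite d m))
    (hRR' : ∀ b : Bond d (fineP L m), (blockCoord L m (bpos b) ∈ Y ∨ blockCoord L m (btgt b) ∈ Y) → R b = R' b)
    (hSS' : ∀ b : Bond d (fineP L m), (blockCoord L m (bpos b) ∈ Y ∨ blockCoord L m (btgt b) ∈ Y) → S b = S' b)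
    (f : SiteL2K 𝕜 d (fineP L m) c₀ W) (hf : ∀ x : TSite d (fineP L m), blockCoord L m x ∉ Y → WL2.equiv 𝕜 _ W f x = 0) :
    covLaplaceSiteK c R S f = covLaplaceSiteK (c₀ := c₀) c R' S' f := by
  have hD : covDerivL2K 𝕜 c₀ c R f = covDerivL2K 𝕜 c₀ c R' f :=
    covDerivL2K_congr c _ hRR' f fun b hb => hf _ fun h => hb (Or.inr h)
  have hoff : ∀ b : Bond d (fineP L m), ¬ (blockCoord L m (bpos b) ∈ Y ∨ blockCoord L m (btgt b) ∈ Y) →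
      WL2.equiv 𝕜 _ W (covDerivL2K 𝕜 c₀ c R' f) b = 0 := fun b hb => by
    rw [equiv_covDerivL2K, covDeriv_apply, hf _ fun h => hb (Or.inr h), hf _ fun h => hb (Or.inl h), map_zero, sub_zero, smul_zero]
  show covDivL2K 𝕜 c₀ c S (covDerivL2K 𝕜 c₀ c R f) = covDivL2K 𝕜 c₀ c S' (covDerivL2K 𝕜 c₀ c R' f)
  rw [hD]
  exact covDivL2K_congr c _ hSS' _ hoff

/-- **(3.4) ON A BOND FIELD SUPPORTED OVER `Z₀` READS THE TRANSPORTERS ONLY ON BONDS WHOSE BASE BLOCK IS WITHIN COARSE DISTANCE `1` OF `Z₀`** — the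
one-step-ahead support bookkeeping of `covCurlL2K_congr` discharged: if `A(x + e_μ, ν) ≠ 0` then `blk(x + e_μ) ∈ Z₀`, so `blk x` is within `1` of `Z₀`.
(The `hlocC` letter of ne9-leaf-06's per-cube reduction, with the same agreement letter as §4.) [folklore]
[cite: Balaban1985BackgroundPropagators, (3.4) p.391, Cor 3.6 p.408; Balaban1985Averaging, (2) p.17] -/
theorem covCurlL2K_congr_of_support (hm : ∀ i, 1 ≤ m i) (c : 𝕜) {R R' : Bond d (fineP L m) → W →ₗ[𝕜] W} (Z₀ : Set (TSite d m))
    (hRR' : ∀ b : Bond d (fineP L m), (∃ z ∈ Z₀, tdist m z (blockCoord L m (bpos b)) ≤ 1) → R b = R' b)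
    (A : BondL2K 𝕜 d (fineP L m) c₀ W) (hA : ∀ b : Bond d (fineP L m), blockCoord L m (bpos b) ∉ Z₀ → WL2.equiv 𝕜 _ W A b = 0) :
    covCurlL2K 𝕜 c₀ c R A = covCurlL2K 𝕜 c₀ c R' A := by
  refine covCurlL2K_congr c (fun x => ∃ z ∈ Z₀, tdist m z (blockCoord L m x) ≤ 1) (fun x hx κ => hRR' (x, κ) hx) A fun x hx μ ν => ?_
  refine hA (shift μ x, ν) fun hin => hx ⟨_, hin, ?_⟩
  rw [tdist_symm hm]
  exact tdist_blockCoord_shift_le_one hm x μ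

end Laplace

section Adjoint

variable {d : ℕ} (L : ℕ) [NeZero L] (m : Fin d → ℕ) {𝔸 : Type*} [Ring 𝔸] [Algebra ℂ 𝔸]
  {W : Type*} [NormedAddCommGroup W] [InnerProductSpace ℂ W] [FiniteDimensional ℂ W] (φ : W ≃ₗ[ℂ] 𝔸) {c₀ : ℝ} [Fact (0 < c₀)] (η : ℝ)

omit [NeZero L] in
/-- **`D_U†z = D_Ũ†z` FOR A BOND FIELD SUPPORTED OVER `Z₀` WHEN `U = Ũ` ON THE BONDS BASED IN `Z₀`** — `D† = D*` ((3.8), `adjoint_covDerivL2K` under `hRS` for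
each background) and (3.8) reads the adjoint transporter `R(U(b)⁻¹)` only where `z` lives. [folklore] [cite: Balaban1985BackgroundPropagators, (3.8) p.392, Cor 3.6 p.408] -/
theorem adjoint_covDerivL2K_congr_of_support (U Ũ : Bond d (fineP L m) → 𝔸ˣ)
    (hRS : ∀ (b : Bond d (fineP L m)) (v u : W), ⟪adTransportW φ U b v, u⟫_ℂ = ⟪v, adTransportW φ (fun b => (U b)⁻¹) b u⟫_ℂ)
    (hRS' : ∀ (b : Bond d (fineP L m)) (v u : W), ⟪adTransportW φ Ũ b v, u⟫_ℂ = ⟪v, adTransportW φ (fun b => (Ũ b)⁻¹) b u⟫_ℂ)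
    (Z₀ : Set (TSite d m)) (hUŨ : ∀ b : Bond d (fineP L m), blockCoord L m (bpos b) ∈ Z₀ → U b = Ũ b)
    (z : BondL2K ℂ d (fineP L m) c₀ W) (hz : ∀ b : Bond d (fineP L m), blockCoord L m (bpos b) ∉ Z₀ → WL2.equiv ℂ _ W z b = 0) :
    LinearMap.adjoint (covDerivL2K ℂ c₀ ((η : ℂ))⁻¹ (adTransportW φ U)) z =
      LinearMap.adjoint (covDerivL2K ℂ c₀ ((η : ℂ))⁻¹ (adTransportW φ Ũ)) z := by
  have hc : conj (((η : ℂ))⁻¹) = ((η : ℂ))⁻¹ := by rw [map_inv₀, Complex.conj_ofReal]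
  rw [adjoint_covDerivL2K ((η : ℂ))⁻¹ hc _ _ hRS, adjoint_covDerivL2K ((η : ℂ))⁻¹ hc _ _ hRS']
  exact covDivL2K_congr _ (fun b => blockCoord L m (bpos b) ∈ Z₀) (fun b hb => adTransportW_inv_congr φ (hUŨ b hb)) z hz

end Adjoint

/-! ## §3 The orthogonal projection `projR Δs Q″` depends only on the constraint kernel and on `Δs` there -/

section ProjR

variable {𝕜 : Type*} [RCLike 𝕜] {E : Type*} [NormedAddCommGroup E] [InnerProductSpace 𝕜 E] [FiniteDimensional 𝕜 E]
  {F₁ F₂ : Type*} [AddCommGroup F₁] [Module 𝕜 F₁] [AddCommGroup F₂] [Module 𝕜 F₂]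

omit [FiniteDimensional 𝕜 E] in
/-- Equal subspaces have equal orthogonal projections. [folklore] -/
private theorem starProjection_congr {K₁ K₂ : Submodule 𝕜 E} [K₁.HasOrthogonalProjection] [K₂.HasOrthogonalProjection] (h : K₁ = K₂) :
    (K₁.starProjection : E →L[𝕜] E) = K₂.starProjection := by
  subst h
  rfl

/-- **`projR` IS A FUNCTION OF THE SUBSPACE `Δs(ker Q″)` ONLY**: if `ker Q₁ = ker Q₂` (as sets) and `Δ₁ = Δ₂` on that kernel, then
`projR Δ₁ Q₁ = projR Δ₂ Q₂` — both are the orthogonal projection onto one subspace ((3.21)). [folklore] [cite: Balaban1985BackgroundPropagators, (3.21)–(3.22) p.394] -/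
theorem projR_congr (Δ₁ Δ₂ : E →ₗ[𝕜] E) (Q₁ : E →ₗ[𝕜] F₁) (Q₂ : E →ₗ[𝕜] F₂) (hker : ∀ l : E, Q₁ l = 0 ↔ Q₂ l = 0)
    (hΔ : ∀ l : E, Q₁ l = 0 → Δ₁ l = Δ₂ l) : projR Δ₁ Q₁ = projR Δ₂ Q₂ := by
  have hK : (LinearMap.ker Q₁).map Δ₁ = (LinearMap.ker Q₂).map Δ₂ := by
    ext v
    rw [Submodule.mem_map, Submodule.mem_map]
    constructor
    · rintro ⟨l, hl, rfl⟩
      have h1 : Q₁ l = 0 := LinearMap.mem_ker.1 hl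
      exact ⟨l, LinearMap.mem_ker.2 ((hker l).1 h1), (hΔ l h1).symm⟩
    · rintro ⟨l, hl, rfl⟩
      have h1 : Q₁ l = 0 := (hker l).2 (LinearMap.mem_ker.1 hl)
      exact ⟨l, LinearMap.mem_ker.2 h1, hΔ l h1⟩
  haveI := hasOrthogonalProjection_of_finiteDimensional (𝕜 := 𝕜) ((LinearMap.ker Q₁).map Δ₁)
  haveI := hasOrthogonalProjection_of_finiteDimensional (𝕜 := 𝕜) ((LinearMap.ker Q₂).map Δ₂)
  have h1 : projR Δ₁ Q₁ = (((LinearMap.ker Q₁).map Δ₁).starProjection : E →L[𝕜] E).toLinearMap := rfl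
  have h2 : projR Δ₂ Q₂ = (((LinearMap.ker Q₂).map Δ₂).starProjection : E →L[𝕜] E).toLinearMap := rfl
  rw [h1, h2, starProjection_congr hK]

end ProjR

/-! ## §4 The cube projection `R_□(U)` reads `U` only over the cube's 1-neighbourhood -/

section Cube

variable {d : ℕ} (L : ℕ) [NeZero L] (m : Fin d → ℕ) {𝔸 : Type*} [Ring 𝔸] [Algebra ℂ 𝔸]
  {W : Type*} [NormedAddCommGroup W] [InnerProductSpace ℂ W] [FiniteDimensional ℂ W] (φ : W ≃ₗ[ℂ] 𝔸)
  {c₀ : ℝ} [Fact (0 < c₀)] {c₁ : ℝ} (η : ℝ)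

/-- **`R_□(U) = R_□(Ũ)` WHEN `U = Ũ` OVER `□⁺`** (Cor 3.6's cube operators read the background on the enlarged cube only): with `N` the site fields supported
over the blocks of the cube `Y` (letter `hN`), `Δ^η_U = D*_U D_U` and `Q′_U = (L²-reading)⁻¹ ∘ Q′(U)` at the transporters `R(U(b))`, `R(U(b)⁻¹)` (letters `hΔs`,
`hQ′`), the same letters for `Ũ`, and `U b = Ũ b` on every bond whose base block is within coarse distance `1` of `Y`:
`projR Δ^η_U (Q′_U × N.mkQ) = projR Δ^η_Ũ (Q′_Ũ × N.mkQ)` — for every `λ ∈ N`, `Q′_Uλ = Q′_Ũλ` (§1) and `Δ^η_Uλ = Δ^η_Ũλ` (§2), so the two constraint kernels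
and their `Δ`-images coincide (§3).  No smallness, no window. [cite: Balaban1985BackgroundPropagators, Cor 3.6 p.408, (3.87) p.409, (3.19) p.393, (3.21)–(3.23) p.394] -/
theorem cube_projR_congr_of_background (hm : ∀ i, 1 ≤ m i) (U Ũ : Bond d (fineP L m) → 𝔸ˣ) (Y : Set (TSite d m))
    (hUŨ : ∀ b : Bond d (fineP L m), (∃ y ∈ Y, tdist m y (blockCoord L m (bpos b)) ≤ 1) → U b = Ũ b)
    {N : Submodule ℂ (SiteL2K ℂ d (fineP L m) c₀ W)}
    (hN : ∀ f : SiteL2K ℂ d (fineP L m) c₀ W, f ∈ N ↔ ∀ x : TSite d (fineP L m), blockCoord L m x ∉ Y → WL2.equiv ℂ _ W f x = 0)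
    (Δs Δs' : SiteL2K ℂ d (fineP L m) c₀ W →ₗ[ℂ] SiteL2K ℂ d (fineP L m) c₀ W)
    (hΔs : Δs = covLaplaceSiteK ((η : ℂ))⁻¹ (adTransportW φ U) (adTransportW φ fun b => (U b)⁻¹))
    (hΔs' : Δs' = covLaplaceSiteK ((η : ℂ))⁻¹ (adTransportW φ Ũ) (adTransportW φ fun b => (Ũ b)⁻¹))
    (Q' Q'' : SiteL2K ℂ d (fineP L m) c₀ W →ₗ[ℂ] SiteL2K ℂ d m c₁ W)
    (hQ' : Q' = (WL2.linearEquiv ℂ ℂ (fun _ : TSite d m => c₁)).symm.toLinearMap ∘ₗ QprimeW L m φ U (c₀ := c₀))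
    (hQ'' : Q'' = (WL2.linearEquiv ℂ ℂ (fun _ : TSite d m => c₁)).symm.toLinearMap ∘ₗ QprimeW L m φ Ũ (c₀ := c₀)) :
    projR Δs (Q'.prod N.mkQ) = projR Δs' (Q''.prod N.mkQ) := by
  -- the agreement letter in the two forms §1/§2 consume
  have hY : ∀ b : Bond d (fineP L m), blockCoord L m (bpos b) ∈ Y → U b = Ũ b := fun b hb =>
    hUŨ b (exists_tdist_le_one_of_endpoint L m hm Y b (Or.inl hb))
  have hY' : ∀ b : Bond d (fineP L m), (blockCoord L m (bpos b) ∈ Y ∨ blockCoord L m (btgt b) ∈ Y) → U b = Ũ b := fun b hb =>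
    hUŨ b (exists_tdist_le_one_of_endpoint L m hm Y b hb)
  -- on `N` the two averagings and the two Laplacians agree
  have hQN : ∀ l ∈ N, Q' l = Q'' l := fun l hl => by
    rw [hQ', hQ'', LinearMap.comp_apply, LinearMap.comp_apply, QprimeW_congr_of_support L m φ U Ũ Y hY l ((hN l).1 hl)]
  have hΔN : ∀ l ∈ N, Δs l = Δs' l := fun l hl => by
    rw [hΔs, hΔs']
    exact covLaplaceSiteK_congr_of_support L m _ Y (fun b hb => adTransportW_congr φ (hY' b hb))
      (fun b hb => adTransportW_inv_congr φ (hY' b hb)) l ((hN l).1 hl)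
  -- the constraint kernels: `(Q′ × mkQ)λ = 0 ↔ Q′λ = 0 ∧ λ ∈ N`
  have hker0 : ∀ (Q : SiteL2K ℂ d (fineP L m) c₀ W →ₗ[ℂ] SiteL2K ℂ d m c₁ W) (l : SiteL2K ℂ d (fineP L m) c₀ W),
      (Q.prod N.mkQ) l = 0 ↔ Q l = 0 ∧ l ∈ N := fun Q l => by
    show (Q l, N.mkQ l) = 0 ↔ _
    rw [Prod.mk_eq_zero, Submodule.mkQ_apply, Submodule.Quotient.mk_eq_zero]
  refine projR_congr Δs Δs' _ _ (fun l => ?_) (fun l hl => ?_)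
  · rw [hker0, hker0]
    constructor
    · rintro ⟨hq, hl⟩
      exact ⟨by rw [← hQN l hl, hq], hl⟩
    · rintro ⟨hq, hl⟩
      exact ⟨by rw [hQN l hl, hq], hl⟩
  · exact hΔN l ((hker0 Q' l).1 hl).2

end Cube

end Literature.MathematicalPhysics.QuantumFieldTheory.Balaban1983to89.B9Eq387CubeProjectionLocality

end
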